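import Summits.HubbardSuperconductivity.HubbardSuperconductivity.Theses.AposterioriCapRg
import Literature.Barriers.HubbardSuperconductivity.PureModelStripeCompetition
import Literature.MathematicalPhysics.QuantumLattice.PairFieldMomentum
import Literature.MathematicalPhysics.QuantumLattice.TorusPairSusceptibility
import Literature.MathematicalPhysics.QuantumLattice.DWaveSource
import Literature.MathematicalPhysics.QuantumLattice.FockRelabel
import HarnessLib

/-!
# Crux `SsbToEvenTorusLro` (stmt-HubbardSuperconductivity-1315) — idea `pair-yrast-landau-floor`
(crux-ideate round 1, ideator 1 gen 2): Sketch of the first lemma and of the line shape.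

REVERSED FEYNMAN–BIJL (momentum-resolved Koma–Tasaki / Tasaki–Watanabe): for an eigenvector
`K ψ = E ψ` of a Hermitian `K` and ANY matrix `A`,
  `⟨ψ, [Aᴴ,[K,A]] ψ⟩ = ⟨Aψ,(K-E)Aψ⟩ + ⟨Aᴴψ,(K-E)Aᴴψ⟩`   (`dotProduct_doubleComm_of_eigen`),
so quadratic-form FLOORS `K ≥ E + g` at the two vectors `Aψ`, `Aᴴψ` turn the (local, `O(L²)`)
double commutator into a CEILING on `‖Aψ‖² + ‖Aᴴψ‖²` (`reversed_feynman_bijl`, proved).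
With `A = Δ_d(q)` (`pairFieldAt dWaveFormFactor L m`), `K = H - μN̂` and `ψ` a sector ground
state, the floor is the PAIR-YRAST (Landau) hypothesis `PairYrastFloorAt` and the ceiling is the
infrared bound `S_ψ(q) ≤ C(1+|μ|)/g(q)` for EVERY ground state; summed over the punctured window
it is `InfraredLeakVanishes`, which the landed Fejér closure
(`Theorems.WcbcsSsbToTorusLRO.stub_fejerClosure`, p72085) combines with fixed-scale sliding-block
face purity into `HasDWavePairFieldLROAt U δ`; `lineShape_holds` (proved) shows the composition
concludes `SsbToEvenTorusLro` BY NAME.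
-/

noncomputable section

set_option linter.dupNamespace false

namespace Summit.HubbardSuperconductivity.HubbardSuperconductivity.Cruxes.SsbToEvenTorusLro.PairYrastLandauFloor

open Literature.MathematicalPhysics.QuantumLattice Literature.Barriers.HubbardSuperconductivity
open Literature.Probability.LatticeModels
open Filter Set Matrix Finset
open scoped ComplexOrder ComplexConjugate Topology
open Summit.HubbardSuperconductivity.HubbardSuperconductivity.Theses.AposterioriCapRg (SsbToEvenTorusLro)

/-! ## §0 The crux, pointwise -/

/-- Density matching (the crux's third antecedent). -/
def DensityMatched (U δ μ : ℝ) : Prop :=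
  Tendsto (fun L : ℕ => ((hubbardTorusWith 2 (L + 1) 1 U μ).groundStateFunctional totalNumber).re /
    ((L + 1 : ℕ) : ℝ) ^ 2) atTop (𝓝 (1 - δ))

/-- The crux is, definitionally, the pointwise transfer into the barrier catalogue's matrix. -/
theorem crux_iff_pointwise :
    SsbToEvenTorusLro ↔ ∀ U δ μ : ℝ, 0 < U → δ ∈ Ioo (0:ℝ) 1 → DensityMatched U δ μ →
      HasDWaveOrder U μ → HasDWavePairFieldLROAt U δ :=
  Iff.rfl

/-! ## §1 The reversed Feynman–Bijl inequality (abstract, PROVED) -/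

section Abstract

variable {n : Type*} [Fintype n] [DecidableEq n]

/-- The double commutator `[Aᴴ, [K, A]] = Aᴴ(KA - AK) - (KA - AK)Aᴴ`. -/
def doubleComm (K A : Matrix n n ℂ) : Matrix n n ℂ :=
  Aᴴ * (K * A - A * K) - (K * A - A * K) * Aᴴ

omit [DecidableEq n] in
theorem star_dotProduct_conjTranspose_mulVec (M : Matrix n n ℂ) (ψ w : n → ℂ) :
    star ψ ⬝ᵥ (Mᴴ *ᵥ w) = star (M *ᵥ ψ) ⬝ᵥ w := by
  rw [star_mulVec, dotProduct_mulVec]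

omit [DecidableEq n] in
theorem star_dotProduct_mulVec' (M : Matrix n n ℂ) (ψ w : n → ℂ) :
    star ψ ⬝ᵥ (M *ᵥ w) = star (Mᴴ *ᵥ ψ) ⬝ᵥ w := by
  rw [← star_dotProduct_conjTranspose_mulVec, conjTranspose_conjTranspose]

omit [DecidableEq n] in
/-- **Double-commutator identity for an eigenvector.** If `K` is Hermitian and `Kψ = Eψ` then
`⟨ψ, [Aᴴ,[K,A]] ψ⟩ = (⟨Aψ, K Aψ⟩ - E‖Aψ‖²) + (⟨Aᴴψ, K Aᴴψ⟩ - E‖Aᴴψ‖²)`. -/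
theorem dotProduct_doubleComm_of_eigen {K : Matrix n n ℂ} (hK : K.IsHermitian) {ψ : n → ℂ} {E : ℝ}
    (hψ : K *ᵥ ψ = (E : ℂ) • ψ) (A : Matrix n n ℂ) :
    star ψ ⬝ᵥ (doubleComm K A *ᵥ ψ) =
      (star (A *ᵥ ψ) ⬝ᵥ (K *ᵥ (A *ᵥ ψ)) - (E : ℂ) * (star (A *ᵥ ψ) ⬝ᵥ (A *ᵥ ψ))) +
      (star (Aᴴ *ᵥ ψ) ⬝ᵥ (K *ᵥ (Aᴴ *ᵥ ψ)) - (E : ℂ) * (star (Aᴴ *ᵥ ψ) ⬝ᵥ (Aᴴ *ᵥ ψ))) := by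
  have hKw : ∀ w : n → ℂ, star ψ ⬝ᵥ (K *ᵥ w) = (E : ℂ) * (star ψ ⬝ᵥ w) := fun w => by
    rw [star_dotProduct_mulVec', hK.eq, hψ, star_smul, smul_dotProduct, smul_eq_mul,
      Complex.star_def, Complex.conj_ofReal]
  have t1 : star ψ ⬝ᵥ (Aᴴ *ᵥ (K *ᵥ (A *ᵥ ψ))) = star (A *ᵥ ψ) ⬝ᵥ (K *ᵥ (A *ᵥ ψ)) :=
    star_dotProduct_conjTranspose_mulVec A ψ _
  have t2 : star ψ ⬝ᵥ (Aᴴ *ᵥ (A *ᵥ (K *ᵥ ψ))) = (E : ℂ) * (star (A *ᵥ ψ) ⬝ᵥ (A *ᵥ ψ)) := by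
    rw [hψ, mulVec_smul, mulVec_smul, dotProduct_smul, smul_eq_mul,
      star_dotProduct_conjTranspose_mulVec]
  have t3 : star ψ ⬝ᵥ (K *ᵥ (A *ᵥ (Aᴴ *ᵥ ψ))) = (E : ℂ) * (star (Aᴴ *ᵥ ψ) ⬝ᵥ (Aᴴ *ᵥ ψ)) := by
    rw [hKw, star_dotProduct_mulVec' A]
  have t4 : star ψ ⬝ᵥ (A *ᵥ (K *ᵥ (Aᴴ *ᵥ ψ))) = star (Aᴴ *ᵥ ψ) ⬝ᵥ (K *ᵥ (Aᴴ *ᵥ ψ)) :=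
    star_dotProduct_mulVec' A ψ _
  have hexp : doubleComm K A *ᵥ ψ =
      (Aᴴ *ᵥ (K *ᵥ (A *ᵥ ψ)) - Aᴴ *ᵥ (A *ᵥ (K *ᵥ ψ))) -
        (K *ᵥ (A *ᵥ (Aᴴ *ᵥ ψ)) - A *ᵥ (K *ᵥ (Aᴴ *ᵥ ψ))) := by
    simp only [doubleComm, sub_mulVec, ← mulVec_mulVec, mulVec_sub]
  rw [hexp, dotProduct_sub, dotProduct_sub, dotProduct_sub, t1, t2, t3, t4]
  ring

omit [DecidableEq n] in
/-- **Reversed Feynman–Bijl.** For a Hermitian `K`, an eigenvector `Kψ = Eψ` and any `A`: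
quadratic-form floors `Re⟨Aψ, K Aψ⟩ ≥ (E + g₁)‖Aψ‖²`, `Re⟨Aᴴψ, K Aᴴψ⟩ ≥ (E + g₂)‖Aᴴψ‖²`
give `g₁‖Aψ‖² + g₂‖Aᴴψ‖² ≤ Re⟨ψ, [Aᴴ,[K,A]] ψ⟩` — a lower bound on the excitation energies of
the modes `Aψ`, `Aᴴψ` is an UPPER bound on their weights (Feynman 1954 read backwards;
Pitaevskii–Stringari 1991; Tasaki–Watanabe 2021 at `q = 0`). -/
theorem reversed_feynman_bijl {K : Matrix n n ℂ} (hK : K.IsHermitian) {ψ : n → ℂ} {E g₁ g₂ : ℝ}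
    (hψ : K *ᵥ ψ = (E : ℂ) • ψ) (A : Matrix n n ℂ)
    (h₁ : (E + g₁) * (star (A *ᵥ ψ) ⬝ᵥ (A *ᵥ ψ)).re ≤ (star (A *ᵥ ψ) ⬝ᵥ (K *ᵥ (A *ᵥ ψ))).re)
    (h₂ : (E + g₂) * (star (Aᴴ *ᵥ ψ) ⬝ᵥ (Aᴴ *ᵥ ψ)).re ≤
      (star (Aᴴ *ᵥ ψ) ⬝ᵥ (K *ᵥ (Aᴴ *ᵥ ψ))).re) :
    g₁ * (star (A *ᵥ ψ) ⬝ᵥ (A *ᵥ ψ)).re + g₂ * (star (Aᴴ *ᵥ ψ) ⬝ᵥ (Aᴴ *ᵥ ψ)).re ≤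
      (star ψ ⬝ᵥ (doubleComm K A *ᵥ ψ)).re := by
  rw [dotProduct_doubleComm_of_eigen hK hψ A]
  simp only [Complex.add_re, Complex.sub_re, Complex.re_ofReal_mul]
  nlinarith [h₁, h₂]

omit [DecidableEq n] in
/-- Corollary (one-sided use): with a floor `g > 0` at `Aψ`, a nonnegative floor at `Aᴴψ`, and a
ceiling `Re⟨ψ,[Aᴴ,[K,A]]ψ⟩ ≤ D`, the weight obeys `‖Aψ‖² ≤ D / g`. -/
theorem weight_le_of_floor {K : Matrix n n ℂ} (hK : K.IsHermitian) {ψ : n → ℂ} {E g D : ℝ}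
    (hψ : K *ᵥ ψ = (E : ℂ) • ψ) (A : Matrix n n ℂ) (hg : 0 < g)
    (h₁ : (E + g) * (star (A *ᵥ ψ) ⬝ᵥ (A *ᵥ ψ)).re ≤ (star (A *ᵥ ψ) ⬝ᵥ (K *ᵥ (A *ᵥ ψ))).re)
    (h₂ : (E + 0) * (star (Aᴴ *ᵥ ψ) ⬝ᵥ (Aᴴ *ᵥ ψ)).re ≤
      (star (Aᴴ *ᵥ ψ) ⬝ᵥ (K *ᵥ (Aᴴ *ᵥ ψ))).re)
    (hD : (star ψ ⬝ᵥ (doubleComm K A *ᵥ ψ)).re ≤ D) :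
    (star (A *ᵥ ψ) ⬝ᵥ (A *ᵥ ψ)).re ≤ D / g := by
  have h := reversed_feynman_bijl hK hψ A h₁ h₂
  rw [le_div_iff₀ hg]
  linarith

end Abstract

/-! ## §2 The line's statements for the Hubbard torus (typed; stubs of a future crux-plan) -/

section Hubbard

/-- The target filling of the crux at side `L`. -/
def fillingN (δ : ℝ) (L : ℕ) : ℕ := 2 * ⌊(1 - δ) * (L : ℝ) ^ 2 / 2⌋₊

/-- **(B) Double-commutator form bound** — `|Re⟨φ, [Δ_d(q)ᴴ,[H - μN̂, Δ_d(q)]] φ⟩| ≤ C(1+|μ|)L²‖φ‖²`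
uniformly in the momentum label: `[K, P_y]` is supported near `y` and `[P_xᴴ, ·]` kills it unless
`x` is within two steps of `y`, so the double commutator is a sum of `L²` local terms
(Koma–Tasaki 1994 Thm 2.2's `4r²ho²N`). Provable now (CAR bookkeeping). -/
def DoubleCommFormBound (U : ℝ) : Prop :=
  ∃ C : ℝ, ∀ (L : ℕ) [NeZero L] (μ : ℝ) (m : TorusSite 2 L) (φ : Fock (Orb (FermionTorus 2 L))),
    |(star φ ⬝ᵥ (doubleComm (hubbardTorusWith 2 L 1 U μ) (pairFieldAt dWaveFormFactor L m) *ᵥ φ)).re| ≤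
      C * (1 + |μ|) * (L : ℝ) ^ 2 * (star φ ⬝ᵥ φ).re

/-- **(Y) Pair-yrast (Landau) floor** at `(U, δ)` — the O(1) stub of the line. Along even sides,
eventually, for every normalised `(N_L, S^z = 0)`-sector ground state `ψ` of the source-free torus
and every nonzero momentum label `m` in the window `|q_m| ≤ η`, there is a chemical potential
`|μ| ≤ M₀` (canonically Lin–Hirsch–Scalapino's midpoint `pairChemicalPotential`) such that
`K = H - μN̂` exceeds `ψ`'s `K`-eigenvalue by at least `c|q_m|^α`, `α < 2`, as a quadratic form
AT the two vectors `Δ_d(q)ψ ∈ (N_L-2)` and `Δ_d(q)ᴴψ ∈ (N_L+2)`. Implied by the momentum-sector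
statement `½[E_{N+2}(P+q) + E_{N-2}(P-q)] - E_N ≥ c|q|^α` (pair-yrast of the torus; Landau's
criterion for pair excitations: `α = 1` in a clean superconductor — phase mode `v_s|q|`, two nodal
quasiparticles `≥ v_Δ|q|` at total momentum `q ≠ 0` — versus `α = 2` in a metal). -/
def PairYrastFloorAt (U δ : ℝ) : Prop :=
  ∃ c α η M₀ : ℝ, 0 < c ∧ α < 2 ∧ 0 < η ∧ ∃ k₀ : ℕ, ∀ k : ℕ, k₀ ≤ k → ∀ [NeZero (2 * k)],
    ∀ ψ : Fock (Orb (FermionTorus 2 (2 * k))), star ψ ⬝ᵥ ψ = 1 →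
      IsGroundStateInSector (hubbardTorus 2 (2 * k) 1 U) (fillingN δ (2 * k)) 0 ψ →
      ∀ m : TorusSite 2 (2 * k), m ≠ 0 → momentumNormSq (2 * k) m ≤ η ^ 2 →
        ∃ μ : ℝ, |μ| ≤ M₀ ∧ ∀ E : ℝ,
          hubbardTorusWith 2 (2 * k) 1 U μ *ᵥ ψ = (E : ℂ) • ψ →
          (E + c * momentumNormSq (2 * k) m ^ (α / 2)) *
              (star (pairFieldAt dWaveFormFactor (2 * k) m *ᵥ ψ) ⬝ᵥ
                (pairFieldAt dWaveFormFactor (2 * k) m *ᵥ ψ)).re ≤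
            (star (pairFieldAt dWaveFormFactor (2 * k) m *ᵥ ψ) ⬝ᵥ
              (hubbardTorusWith 2 (2 * k) 1 U μ *ᵥ (pairFieldAt dWaveFormFactor (2 * k) m *ᵥ ψ))).re ∧
          (E + c * momentumNormSq (2 * k) m ^ (α / 2)) *
              (star ((pairFieldAt dWaveFormFactor (2 * k) m)ᴴ *ᵥ ψ) ⬝ᵥ
                ((pairFieldAt dWaveFormFactor (2 * k) m)ᴴ *ᵥ ψ)).re ≤
            (star ((pairFieldAt dWaveFormFactor (2 * k) m)ᴴ *ᵥ ψ) ⬝ᵥ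
              (hubbardTorusWith 2 (2 * k) 1 U μ *ᵥ
                ((pairFieldAt dWaveFormFactor (2 * k) m)ᴴ *ᵥ ψ))).re

/-- **(IR) Vanishing infrared leak** — the punctured-window pair weight of every sector ground
state is small, uniformly in large even `L`: exactly the second term of the landed Fejér closure
`stub_fejerClosure`. In this line it is the OUTPUT of (Y)+(B) (`infraredLeak_of_yrast`, provable
now: `S_ψ(m)/L² ≤ C(1+M₀)/(c|q_m|^α L²)` by `weight_le_of_floor`, and
`L⁻² Σ_{0<|q|<η} |q|^{-α} ≤ C_α η^{2-α}`). -/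
def InfraredLeakVanishes (U δ : ℝ) : Prop :=
  ∀ ε : ℝ, 0 < ε → ∃ η : ℝ, 0 < η ∧ ∃ k₀ : ℕ, ∀ k : ℕ, k₀ ≤ k → ∀ [NeZero (2 * k)],
    ∀ ψ : Fock (Orb (FermionTorus 2 (2 * k))), star ψ ⬝ᵥ ψ = 1 →
      IsGroundStateInSector (hubbardTorus 2 (2 * k) 1 U) (fillingN δ (2 * k)) 0 ψ →
      (∑ m ∈ (Finset.univ.filter fun m : TorusSite 2 (2 * k) =>
          m ≠ 0 ∧ momentumNormSq (2 * k) m < η ^ 2),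
        pairStructureFactor dWaveFormFactor (2 * k) ψ m) / ((2 * k : ℕ) : ℝ) ^ 2 ≤ ε

/-- The yrast step of the line (provable now from §1 + arithmetic). -/
def InfraredLeakOfYrast : Prop :=
  ∀ U δ : ℝ, PairYrastFloorAt U δ → DoubleCommFormBound U → InfraredLeakVanishes U δ

/-- **(FP) Sliding-block face purity** at fixed scale `R` (the pool's thermodynamic half — any of
the convexity cards, e.g. `number-projected-canonical-slope`, supplies it under the antecedents):
eventually along even sides every normalised sector ground state has average block pair coherence
`Σ_a ‖B_a ψ‖²/(R⁴L²) ≥ m² - ε`, `m = dWaveOrderParameter U μ`, blocks `B_a = Σ_{u∈[0,R)²} P_{a+u}`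
exactly as in `stub_fejerClosure`. -/
def SlidingBlockFacePurity (U δ μ : ℝ) : Prop :=
  ∀ R : ℕ, 0 < R → ∀ ε : ℝ, 0 < ε → ∃ k₀ : ℕ, ∀ k : ℕ, k₀ ≤ k → ∀ [NeZero (2 * k)],
    ∀ ψ : Fock (Orb (FermionTorus 2 (2 * k))), star ψ ⬝ᵥ ψ = 1 →
      IsGroundStateInSector (hubbardTorus 2 (2 * k) 1 U) (fillingN δ (2 * k)) 0 ψ →
      dWaveOrderParameter U μ ^ 2 - ε ≤
        (∑ a : TorusSite 2 (2 * k),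
          star ((∑ u : Fin 2 → Fin R,
              localPair dWaveFormFactor (2 * k) (a + fun i => ((u i : ℕ) : ZMod (2 * k)))) *ᵥ ψ) ⬝ᵥ
            ((∑ u : Fin 2 → Fin R,
              localPair dWaveFormFactor (2 * k) (a + fun i => ((u i : ℕ) : ZMod (2 * k)))) *ᵥ ψ)).re /
          ((R : ℝ) ^ 4 * ((2 * k : ℕ) : ℝ) ^ 2)

/-- **Closure** (provable now from `stub_fejerClosure` and `liminf` bookkeeping): face purity at
every fixed scale + vanishing infrared leak ⇒ the summit matrix, with the explicit floor
`lro ≥ m² - ε - κ(η) - 2π²C_d²/(R²η²) ≥ m²/2`. -/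
def YrastClosure : Prop :=
  ∀ U δ μ : ℝ, HasDWaveOrder U μ → SlidingBlockFacePurity U δ μ → InfraredLeakVanishes U δ →
    HasDWavePairFieldLROAt U δ

/-- **Line shape** — the composition a crux-plan would register as `SsbToEvenTorusLro_of`:
(FP under the antecedents) → (Y under the antecedents) → (B) → (yrast step) → (closure) → crux. -/
def LineShape : Prop :=
  (∀ U δ μ : ℝ, 0 < U → δ ∈ Ioo (0:ℝ) 1 → DensityMatched U δ μ → HasDWaveOrder U μ →
      SlidingBlockFacePurity U δ μ) →
  (∀ U δ μ : ℝ, 0 < U → δ ∈ Ioo (0:ℝ) 1 → DensityMatched U δ μ → HasDWaveOrder U μ →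
      PairYrastFloorAt U δ) →
  (∀ U : ℝ, 0 < U → DoubleCommFormBound U) →
  InfraredLeakOfYrast → YrastClosure → SsbToEvenTorusLro

/-- The composition is pure logic and concludes the crux BY NAME. -/
theorem lineShape_holds : LineShape :=
  fun hFP hY hB hIR hC U δ μ hU hδ hd ho =>
    hC U δ μ ho (hFP U δ μ hU hδ hd ho) (hIR U δ (hY U δ μ hU hδ hd ho) (hB U hU))

end Hubbard

/-! ## §3 The supplier side (typed): spectral floors cross the `h → 0⁺` interchange by Weyl
continuity — the SOURCED, `h`-uniform momentum floor and its `h = 0` shadow -/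

section Supplier

/-- The momentum-`k` subspace of the fermionic Fock space of the torus: joint eigenvectors of the
translation unitaries `fockTranslate v` with eigenvalues `χ_k(v)` (character convention of
`torusChar`; the sign convention is immaterial for the floors below, which quantify over all
nonzero `k` in a symmetric window). -/
def momentumSubspace (L : ℕ) [NeZero L] (k : TorusSite 2 L) :
    Submodule ℂ (Fock (Orb (FermionTorus 2 L))) :=
  ⨅ v : TorusSite 2 L,
    Module.End.eigenspace (Matrix.toLin' (fockTranslate v).val) (torusChar k v)

/-- **(Yₕ) `h`-UNIFORM sourced momentum floor** — the engine-native form of the Landau input: for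
the grand-canonical torus WITH the uniform `d`-wave source `h ∈ (0, h₀]` (phase pinned, Goldstone
mode massive), every state of nonzero momentum `q` in the window costs at least `c|q|^α` above the
sourced ground energy, for all `L ≥ L₀` with `L₀` INDEPENDENT of `h`. Uniformity in `h` is natural
because the only `h`-sensitive soft degree of freedom as `h → 0` — the global phase/number zero
mode (the tower) — carries ZERO momentum. -/
def SourcedMomentumFloorUniform (U μ : ℝ) : Prop :=
  ∃ c α η h₀ : ℝ, 0 < c ∧ α < 2 ∧ 0 < η ∧ 0 < h₀ ∧ ∃ L₀ : ℕ, ∀ L : ℕ, L₀ ≤ L → ∀ [NeZero L],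
    ∀ h ∈ Ioc (0:ℝ) h₀, ∀ k : TorusSite 2 L, k ≠ 0 → momentumNormSq L k ≤ η ^ 2 →
      ∀ φ ∈ momentumSubspace L k,
        ((dWaveSourceTorus L U μ h).groundEnergy + c * momentumNormSq L k ^ (α / 2)) *
            (star φ ⬝ᵥ φ).re ≤ (star φ ⬝ᵥ (dWaveSourceTorus L U μ h *ᵥ φ)).re

/-- **(Y₀) its `h = 0` shadow**: the same floor for the source-free grand-canonical torus. -/
def MomentumFloorAtZeroSource (U μ : ℝ) : Prop :=
  ∃ c α η : ℝ, 0 < c ∧ α < 2 ∧ 0 < η ∧ ∃ L₀ : ℕ, ∀ L : ℕ, L₀ ≤ L → ∀ [NeZero L],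
    ∀ k : TorusSite 2 L, k ≠ 0 → momentumNormSq L k ≤ η ^ 2 →
      ∀ φ ∈ momentumSubspace L k,
        ((hubbardTorusWith 2 L 1 U μ).groundEnergy + c * momentumNormSq L k ^ (α / 2)) *
            (star φ ⬝ᵥ φ).re ≤ (star φ ⬝ᵥ (hubbardTorusWith 2 L 1 U μ *ᵥ φ)).re

/-- **Weyl transfer (provable now).** At FIXED `L` both sides of the floor are continuous in `h`
(`‖K_h - K_0‖ ≤ 2h‖Δ_d‖ ≤ 2h·C_d L²`, and `|E₀(K_h) - E₀(K_0)| ≤ ‖K_h - K_0‖`), and the floor's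
`L₀` does not depend on `h`; letting `h → 0⁺` in (Yₕ) gives (Y₀). The `h → 0⁺`-after-`L → ∞`
interchange, fatal for ORDER PARAMETERS (`Re ω_{L,h}(Δ_d)/L²` jumps from `m` to `0`), is free for
spectral FLOORS. -/
def WeylTransfer : Prop :=
  ∀ U μ : ℝ, SourcedMomentumFloorUniform U μ → MomentumFloorAtZeroSource U μ

/-- **Sector bookkeeping (Y₀ ⇒ Y).** What turns the grand-canonical `h = 0` floor into the
sector/channel floor (Y) used by the closure: (i) the sector excess
`E^K_{(N_L, 0)} - E₀(K) ≤ γ_L = o(L⁻¹)` at the working chemical potential (discrete convexity of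
`N ↦ E₀(N)` near `N_L` at resolution `L⁻²`: the charging energy, Lin–Hirsch–Scalapino's `μ̄`,
`pairGap ≥ 0`), and (ii) momentum decomposition of `Δ_d(q)ψ` (the Hamiltonian commutes with
`fockTranslate`, so cross terms vanish). Named, not typed further here. -/
def SectorFloorOfMomentumFloor : Prop :=
  ∀ U δ μ : ℝ, DensityMatched U δ μ → MomentumFloorAtZeroSource U μ → PairYrastFloorAt U δ

end Supplier

end Summit.HubbardSuperconductivity.HubbardSuperconductivity.Cruxes.SsbToEvenTorusLro.PairYrastLandauFloor
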